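import Summits.CriticalPhenomena.PercolationContinuityZ3.Theorems.PercNearOneGluingNoHeavyLowerTailThreePartitionGridHall
import HarnessLib.Audit

/-!
# `NoHeavyLowerTail` (crux stmt-CriticalPhenomena-4575), master-family hierarchy P3 (gen 36): COMB-C3 IN MATCHING FORM —
# `ThreePartitionPositivityTwisted` is EQUIVALENT to the existence, for every `(τ,𝒱,𝒲)`, of a token matching that only grows copy 1
# (the CYLINDER order), the weakest of the transport forms

Support file (seat `prim-masterthm-p3`; `--supports stmt-CriticalPhenomena-4575`; memo
`run/shared/lean/prim/prim-masterthm/FROM-prim-masterthm-p3-g36-CYLINDER-SLACK.md`).  Companion of `…ThreePartitionGridMatching`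
(tokens `negToks` / `posToks`, `sum_gtKernel_eq_card_sub_card`, the grid-order matching `GTMatchable`), `…ThreePartitionGridHall`
(Hall for the grid order) and `…ThreePartitionGridTransport` (`threePartNT = Σ [x₁ ∈ 𝒰] κ`).

THE CYLINDER ORDER (this file).  `ThreePartitionPositivityTwisted` (≡ COMB-C3 ⟹ Sahi's `C₃` for product measures) asks `∑_{q : x₁(q) ∈ 𝒰} κ ≥ 0`
only for CYLINDERS `{x₁ ∈ 𝒰}` over up-sets `𝒰` of the cube, not for all grid up-sets as `GridTransport` does.  By Hall's theorem this is
EQUIVALENT to a token matching in which a negative token at `q` may use any positive token at a configuration `q'` with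
`x₁(q) ⊆ x₁(q')` — copies 2 and 3 are unconstrained (`CylMatchable`; `cylMatchable_iff`, `threePartitionPositivityTwisted_iff_cylMatchable`).
Every grid matching is a cylinder matching (`cylMatchable_of_gtMatchable`), so this is the weakest matching form in the chain
`TypedMatchable ⟹ GTMatchable ⟹ CylMatchable`; the seat's gen-36 census (memo §3) shows the extra freedom is real: for the cylinder count
`N(𝒰) = E_ψ(𝒰) + K_O(𝒰) + H(𝒰) − cost(Div) + refund(Div)` two slack terms (`E_ψ`: landers entering the cylinder; `refund`: the unused mirror
`T₂` tokens of diverted bad tokens) are invisible to grid matchings.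
HONEST LABEL: Hall's marriage theorem applied to an identity already in the tree; `ThreePartitionPositivityTwisted`, COMB-C3 and Sahi's `C₃`
remain OPEN; nothing here bears on the (closed) crux. [this work]
-/

noncomputable section

open Finset
open scoped symmDiff Classical

namespace Summit.CriticalPhenomena.PercolationContinuityZ3.Theorems.ThreePartition

variable {ι : Type*} [Fintype ι]

/-- **`CylMatchable τ 𝒱 𝒲`**: the negative tokens of `(τ,𝒱,𝒲)` can be sent injectively to positive tokens at configurations whose copy 1
CONTAINS their own copy 1 (the cylinder order; copies 2 and 3 unconstrained). [this work] -/
def CylMatchable (τ : Set ι) (𝒱 𝒲 : Set (Set ι)) : Prop :=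
  ∃ Φ : (Set ι × Set ι) × Fin 3 → (Set ι × Set ι) × Fin 3,
    (∀ t ∈ negToks τ 𝒱 𝒲, Φ t ∈ posToks τ 𝒱 𝒲 ∧ cp₁ τ t.1 ⊆ cp₁ τ (Φ t).1) ∧ Set.InjOn Φ (negToks τ 𝒱 𝒲)

/-- A grid matching is a cylinder matching. [this work] -/
theorem cylMatchable_of_gtMatchable {τ : Set ι} {𝒱 𝒲 : Set (Set ι)} (h : GTMatchable τ 𝒱 𝒲) : CylMatchable τ 𝒱 𝒲 := by
  obtain ⟨Φ, hΦ, hinj⟩ := h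
  exact ⟨Φ, fun t ht => ⟨(hΦ t ht).1, (hΦ t ht).2.1⟩, hinj⟩

omit [Fintype ι] in
/-- The CYLINDER over a family `𝒰` of the cube: the configurations whose copy 1 lies in `𝒰` (kept as a definition so that all `filter`s
below elaborate with the classical decidability instance). [this work] -/
def cyl (τ : Set ι) (𝒰 : Set (Set ι)) : Set (Set ι × Set ι) := {q | cp₁ τ q ∈ 𝒰}

omit [Fintype ι] in
/-- Membership in the cylinder. [this work] -/
theorem mem_cyl {τ : Set ι} {𝒰 : Set (Set ι)} {q : Set ι × Set ι} : q ∈ cyl τ 𝒰 ↔ cp₁ τ q ∈ 𝒰 := Iff.rfl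

/-- The twisted functional as the kernel sum over the cylinder `{q : x₁(q) ∈ 𝒰}`. [this work] -/
theorem threePartNT_eq_sum_filter (τ : Set ι) (𝒰 𝒱 𝒲 : Set (Set ι)) :
    threePartNT τ 𝒰 𝒱 𝒲 = ∑ q ∈ (cfgs ι).filter (fun q => q ∈ cyl τ 𝒰), gtKernel τ 𝒱 𝒲 q := by
  rw [threePartNT_eq_sum_gtKernel, Finset.sum_filter]
  refine Finset.sum_congr rfl fun q _ => ?_
  unfold ind
  simp only [mem_cyl]
  split_ifs <;> simp

/-- **Easy direction**: a cylinder matching proves `N_τ(𝒰,𝒱,𝒲) ≥ 0` for every up-set `𝒰`. [this work] -/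
theorem threePartNT_nonneg_of_cylMatchable {τ : Set ι} {𝒱 𝒲 : Set (Set ι)} (h : CylMatchable τ 𝒱 𝒲) {𝒰 : Set (Set ι)}
    (h𝒰 : IsUpperSet 𝒰) : 0 ≤ threePartNT τ 𝒰 𝒱 𝒲 := by
  obtain ⟨Φ, hΦ, hinj⟩ := h
  rw [threePartNT_eq_sum_filter, sum_gtKernel_eq_card_sub_card, sub_nonneg, Nat.cast_le]
  refine card_le_card_of_injOn Φ (fun t ht => ?_) (fun t ht t' ht' htt' => ?_)
  · rw [mem_coe, mem_filter] at ht ⊢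
    obtain ⟨hpos, hle⟩ := hΦ t ht.1
    exact ⟨hpos, mem_cyl.2 (h𝒰 hle (mem_cyl.1 ht.2))⟩
  · rw [mem_coe, mem_filter] at ht ht'
    exact hinj ht.1 ht'.1 htt'

/-- **Hall, hard direction**: if `N_τ(𝒰,𝒱,𝒲) ≥ 0` for every up-set `𝒰` of the cube, the negative tokens admit a cylinder matching. [this work] -/
theorem cylMatchable_of_threePartNT_nonneg (τ : Set ι) (𝒱 𝒲 : Set (Set ι))
    (h : ∀ 𝒰 : Set (Set ι), IsUpperSet 𝒰 → 0 ≤ threePartNT τ 𝒰 𝒱 𝒲) : CylMatchable τ 𝒱 𝒲 := by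
  let t : negToks τ 𝒱 𝒲 → Finset ((Set ι × Set ι) × Fin 3) :=
    fun n => (posToks τ 𝒱 𝒲).filter fun p => cp₁ τ n.1.1 ⊆ cp₁ τ p.1
  have hHall : ∀ s : Finset (negToks τ 𝒱 𝒲), #s ≤ #(s.biUnion t) := by
    intro s
    -- the up-closure `𝒰` (in the cube) of the first copies of the configurations of `s`
    obtain ⟨𝒰, h𝒰mem⟩ : ∃ 𝒰 : Set (Set ι), ∀ a, a ∈ 𝒰 ↔ ∃ n ∈ s, cp₁ τ n.1.1 ⊆ a :=
      ⟨{a | ∃ n ∈ s, cp₁ τ n.1.1 ⊆ a}, fun _ => Iff.rfl⟩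
    have h𝒰 : IsUpperSet 𝒰 := by
      intro a a' hle ha
      obtain ⟨n, hn, hna⟩ := (h𝒰mem a).1 ha
      exact (h𝒰mem a').2 ⟨n, hn, hna.trans hle⟩
    have hbi : s.biUnion t = (posToks τ 𝒱 𝒲).filter fun p => p.1 ∈ cyl τ 𝒰 := by
      ext p
      simp only [mem_biUnion, mem_filter, t, mem_cyl, h𝒰mem]
      constructor
      · rintro ⟨n, hn, hp, hg⟩
        exact ⟨hp, n, hn, hg⟩
      · rintro ⟨hp, n, hn, hg⟩
        exact ⟨n, hn, hp, hg⟩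
    have hsN : #s ≤ #((negToks τ 𝒱 𝒲).filter fun p => p.1 ∈ cyl τ 𝒰) := by
      calc #s = #(s.map (Function.Embedding.subtype _)) := (card_map _).symm
        _ ≤ #((negToks τ 𝒱 𝒲).filter fun p => p.1 ∈ cyl τ 𝒰) := by
          refine card_le_card fun p hp => ?_
          obtain ⟨n, hn, rfl⟩ := mem_map.1 hp
          exact mem_filter.2 ⟨n.2, mem_cyl.2 ((h𝒰mem _).2 ⟨n, hn, subset_rfl⟩)⟩
    have hsum := h 𝒰 h𝒰
    rw [threePartNT_eq_sum_filter, sum_gtKernel_eq_card_sub_card, sub_nonneg, Nat.cast_le] at hsum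
    rw [hbi]
    exact hsN.trans hsum
  obtain ⟨f, hf, hft⟩ := (all_card_le_biUnion_card_iff_exists_injective t).1 hHall
  refine ⟨fun p => if hp : p ∈ negToks τ 𝒱 𝒲 then f ⟨p, hp⟩ else p, fun p hp => ?_, fun p hp p' hp' hpp' => ?_⟩
  · have hp' : p ∈ negToks τ 𝒱 𝒲 := hp
    simp only [dif_pos hp']
    have hm := mem_filter.1 (hft ⟨p, hp'⟩)
    exact ⟨hm.1, hm.2⟩
  · have h1 : p ∈ negToks τ 𝒱 𝒲 := hp
    have h2 : p' ∈ negToks τ 𝒱 𝒲 := hp'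
    simp only [dif_pos h1, dif_pos h2] at hpp'
    exact congrArg Subtype.val (hf hpp')

/-- **Hall for the cylinder order**: a cylinder matching exists iff `N_τ(𝒰,𝒱,𝒲) ≥ 0` for every up-set `𝒰`. [this work] -/
theorem cylMatchable_iff (τ : Set ι) (𝒱 𝒲 : Set (Set ι)) :
    CylMatchable τ 𝒱 𝒲 ↔ ∀ 𝒰 : Set (Set ι), IsUpperSet 𝒰 → 0 ≤ threePartNT τ 𝒰 𝒱 𝒲 :=
  ⟨fun h _ h𝒰 => threePartNT_nonneg_of_cylMatchable h h𝒰, cylMatchable_of_threePartNT_nonneg τ 𝒱 𝒲⟩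

/-- **`ThreePartitionPositivityTwisted` (≡ COMB-C3) is the statement that every instance admits a CYLINDER matching** — the weakest of
the matching forms `TypedMatchable ⟹ GTMatchable ⟹ CylMatchable`. [this work] -/
theorem threePartitionPositivityTwisted_iff_cylMatchable :
    ThreePartitionPositivityTwisted ↔
      ∀ (ι : Type) [Fintype ι] (τ : Set ι) (𝒱 𝒲 : Set (Set ι)), IsUpperSet 𝒱 → IsUpperSet 𝒲 → CylMatchable τ 𝒱 𝒲 := by
  constructor
  · intro h ι _ τ 𝒱 𝒲 h𝒱 h𝒲
    exact cylMatchable_of_threePartNT_nonneg τ 𝒱 𝒲 fun 𝒰 h𝒰 => h ι τ 𝒰 𝒱 𝒲 h𝒰 h𝒱 h𝒲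
  · intro h ι _ τ 𝒰 𝒱 𝒲 h𝒰 h𝒱 h𝒲
    exact threePartNT_nonneg_of_cylMatchable (h ι τ 𝒱 𝒲 h𝒱 h𝒲) h𝒰

end Summit.CriticalPhenomena.PercolationContinuityZ3.Theorems.ThreePartition

end
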